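import Literature.MathematicalPhysics.QuantumFieldTheory.Balaban1983to89.Node00.OpsYOps312OfRecordPar
import Literature.MathematicalPhysics.QuantumFieldTheory.Balaban1983to89.B9LettersZCFieldsAtPins
import Literature.MathematicalPhysics.QuantumFieldTheory.Balaban1983to89.B9BackgroundsKLevelV1R

/-!
# BalabanUVNodes ∕ N06 ([B9], `Dag.B9_main`) — CASCADE-K PIECE K2 (director-ym №383): THE DISPLAYED LAWS OF THE ROWS-20∕21 ASSEMBLER
# `…N06Thm312313AtPinsStateSUCLEPar.t312_t313_of_pins_stateSUCLE_par` AT A GENERIC AVERAGING PAIR AND AT THE KNIT PAIR OF RECORD — PART 1: the law `hC1T` (`C₁(U)` is its own counting transpose; the law `hqK` is the sequel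
# `…N06Thm312313ParLawsQRow`)

Track A of `YM-PLAN.md` (cell `pub-ymgap`, HUMAN RULING D-0062), node **N06** = [Balaban1985BackgroundPropagators] Thms 3.1–3.15; bundle F7 rows 20–21, seat
`pub-ymgap-dag-n06-l` (g37).  WHY.  The assembler `t312_t313_of_pins_stateSUCLE_par` (this seat, CASCADE-K K2 item 4) turned three pair∕transporter-specific
derivations of face v1.7 into displayed LAWS of the Sect.-D operator record `𝔬12`: `hqK` (the `Q`-letters), `hqsK` (the `Q⋆`-majorant) and
`hC1T : … Reg335 c α₀ U → Reg336 c α₀ U → IsTransposePair ((𝔬12 x).C1 U) ((𝔬12 x).C1 U)` — the symmetry of `C₁ = (𝔮G₁𝔮⋆)⁻¹` (3.132) read in n06-d's real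
coordinates, which dag-n06-w5's Schur step `c1_l2_of_c1_2` needs for the block-L² field `c1` of row 21.  THIS FILE inhabits `hC1T` at node00-def-Y's `𝔮`-generic
model `C1coKq … 𝔮 𝔮s parS Gp Δ2` (`Node00.OpsYOps312OfRecordPar` §0, the shape of `pins312Par_of_eq`'s conjunct `hC1co12`): §1 ★ `isTransposePair_C1coKq_of_isSymmTr`
(from `IsSymmTr (QG1QinvQY …)`: w5's `isTransposePair_coordOpK_of_isSymmTr` at the trace basis + `isTransposePair_smul`) and ★★ `isTransposePair_C1coKq_of_laws` (from the
laws def-Y's `QG1QinvQY_isSymmTr` consumes: `U` and the site transporter's legs `G`-valued, `G ≤ U(N)`; `(𝔮, 𝔮⋆)` an adjoint pair at `U`; `G′` and `R` symmetric;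
`Δ⁽²⁾(U)` symmetric); §2 ★★★ `isTransposePair_C1coKq_knit_of_laws` — AT THE KNIT PAIR OF RECORD `(qKnitOfRecord, qsKnitOfRecord)` (print's (3.115) letter and its
generic adjoint, `isAdjOnQ_qKnitOfRecord` for free), the knit transporter `parKnitY` and `G′_phys(parKnitY)`: from `U` SU(N)-valued, the knit legs U(N)-valued
(dag-n06-d's law KL1 `lawsK_parKnitY_of_reg335P` on (3.35); F5's `parKnitY_mem_unitary_of_reg335P`) and `Δ⁽²⁾(U)` symmetric — def-Y's `QG1QinvQY_GpPhysY_isSymmTr_parKnitY`;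
and ★★★ `hC1T_knit_of_laws` — the certificate's binder shape: at any `𝔬12` pinned by `hC1co12` to the knit model, the law `hC1T` from two displayed member laws
(`hparK` : knit legs U(N)-valued on the classes; `hΔ2` : `Δ⁽²⁾(U)` symmetric for SU(N)-valued `U`).  Today's straight pair is w5's `isTransposePair_C1coK` (unchanged).
HONEST FRAMING.  Kernel bookkeeping over def-Y's symmetric-letter lemmas; the member laws are HYPOTHESES; COUNT-NEUTRAL; nothing of [B9]'s estimates asserted;
N06 NOT discharged; one finite 𝕋⁴ programme at fixed `ε` — NOT continuum, NOT OS, NOT the mass gap ∕ Clay.  0 `def`, 0 `sorry`.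
-/

noncomputable section

namespace Summit.QuantumFields.YangMills.BalabanUVNodes.N06Thm312313ParLawsQ

open scoped Matrix.Norms.L2Operator
open Literature.MathematicalPhysics.QuantumFieldTheory.Balaban1983to89
open Literature.MathematicalPhysics.QuantumFieldTheory.Balaban1983to89.Node00
open Literature.MathematicalPhysics.QuantumFieldTheory.Balaban1983to89.B6KLevelCensusIndexV1 (KIdx)
open Literature.MathematicalPhysics.QuantumFieldTheory.Balaban1983to89.B9PinMembersKLevelV1 (MemberY geo9Y bg9Y)
open Literature.MathematicalPhysics.QuantumFieldTheory.Balaban1983to89.B9BackgroundsKLevelV1R (RegFamY bg9YR MemOfFam mem_of_reg335R)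
open Literature.MathematicalPhysics.QuantumFieldTheory.Balaban1983to89.B7Prop2SpecialUnitary (specialUnitaryUnits specialUnitaryUnits_le_unitaryUnits)
open Literature.MathematicalPhysics.QuantumFieldTheory.Balaban1983to89.B9CoReadingCoordsTranspose (TrIdx trBasis trBasis_repr_eq_trace isTransposePair_coordOpK_of_isSymmTr)
open Literature.MathematicalPhysics.QuantumFieldTheory.Balaban1983to89.B9CoReadingCoords (XBK coordOpK)
open Literature.MathematicalPhysics.QuantumFieldTheory.Balaban1983to89.B9CoReadingCoordsH (XHK)
open Literature.MathematicalPhysics.QuantumFieldTheory.Balaban1983to89.B9Thm312Whole (Ops)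
open Literature.MathematicalPhysics.QuantumFieldTheory.Balaban1983to89.B9Thm37Glue (IsTransposePair)
open Literature.MathematicalPhysics.QuantumFieldTheory.Balaban1983to89.B9Thm37GlueTorusCov (isTransposePair_smul)
open Literature.MathematicalPhysics.QuantumFieldTheory.Balaban1983to89.B9Thm311ReadingCoords (IsSymmTr IsAdjTr)
open Literature.MathematicalPhysics.QuantumFieldTheory.Balaban1983to89.B9Thm39ReadingCoords (cR39)
open Literature.MathematicalPhysics.QuantumFieldTheory.Balaban1983to89.B9B8AveragingJunction (parKnitY)
open Literature.MathematicalPhysics.QuantumFieldTheory.Balaban1983to89.Node00.OpsYOps312OfRecordPar (C1coKq)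
open Literature.MathematicalPhysics.QuantumFieldTheory.Balaban1983to89.Node00.OpsYQLetter (QLetterY QsLetterY qKnitOfRecord qsKnitOfRecord isAdjTr_adjTrY)

variable {N : ℕ}

/-! ## §1 The law `hC1T` at a generic averaging pair: `C₁(U)` in coordinates is its own counting transpose when `(𝔮G₁𝔮⋆)⁻¹(U)` is symmetric -/

section Generic

variable {d ℓ : ℕ} {hd : 1 ≤ d + 1} {hL : Odd (ℓ + 1) ∧ 1 < ℓ + 1} {b₀ b₁ : ℝ} (i : KIdx d ℓ hd hL b₀ b₁)
  (B : B9.Backgrounds) (cfg : B.Cfg → CfgY (Matrix (Fin N) (Fin N) ℂ) i)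
  (𝔮 : QLetterY (Matrix (Fin N) (Fin N) ℂ) i) (𝔮s : QsLetterY (Matrix (Fin N) (Fin N) ℂ) i)
  (parS : SiteParY (Matrix (Fin N) (Fin N) ℂ) i) (Gp : SiteOpY (Matrix (Fin N) (Fin N) ℂ) i) (Δ2 : BondOpY (Matrix (Fin N) (Fin N) ℂ) i) (U₁ : B.Cfg)

/-- ★ **`C₁(U)` IN COORDINATES IS ITS OWN COUNTING TRANSPOSE WHEN `(𝔮G₁𝔮⋆)⁻¹(U)` IS SYMMETRIC** — def-Y's `𝔮`-generic model `C1coKq = cR39 • coordOpK ((𝔮G₁𝔮⋆)⁻¹(U))`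
read through dag-n06-w5's `isTransposePair_coordOpK_of_isSymmTr` at the trace basis. [cite: Balaban1985BackgroundPropagators, (3.132) p.422, p.391 (the L² scalar products), (3.13) p.393] -/
theorem isTransposePair_C1coKq_of_isSymmTr (hC : IsSymmTr (fun _ => (1 : ℝ)) (QG1QinvQY i 𝔮 𝔮s parS Gp Δ2 (cfg U₁))) :
    IsTransposePair (C1coKq i (trBasis N) B cfg 𝔮 𝔮s parS Gp Δ2 U₁) (C1coKq i (trBasis N) B cfg 𝔮 𝔮s parS Gp Δ2 U₁) := by
  unfold C1coKq
  exact isTransposePair_smul (isTransposePair_coordOpK_of_isSymmTr (trBasis N) (trBasis_repr_eq_trace N) _ hC) _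

/-- ★★ **THE LAW `hC1T` FROM THE LETTER LAWS** (def-Y's `QG1QinvQY_isSymmTr`): `U` and the site transporter irrelevant beyond `G`-valuedness (`G ≤ U(N)`), `(𝔮, 𝔮⋆)` an
adjoint pair at `U`, `G′(U)` and `R(U)` symmetric, `Δ⁽²⁾(U)` symmetric ⟹ `C₁(U)` in coordinates is its own counting transpose.
[cite: Balaban1985BackgroundPropagators, (3.132) p.422, (3.128)–(3.129) p.421, (3.25) p.394, (3.13) p.393] -/
theorem isTransposePair_C1coKq_of_laws {G : Subgroup (Matrix (Fin N) (Fin N) ℂ)ˣ} (hG : G ≤ B7Prop2Explicit.unitaryUnits (Matrix (Fin N) (Fin N) ℂ))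
    (hU : ∀ μ x, cfg U₁ μ x ∈ G) (hQ : IsAdjTr (fun _ => (1 : ℝ)) (fun _ => (1 : ℝ)) (𝔮 (cfg U₁)) (𝔮s (cfg U₁)))
    (hGp : IsSymmTr (fun _ => (1 : ℝ)) (Gp (cfg U₁))) (hR : IsSymmTr (fun _ => (1 : ℝ)) (RY i parS Gp (cfg U₁)))
    (hΔ2 : IsSymmTr (fun _ => (1 : ℝ)) (Δ2 (cfg U₁))) :
    IsTransposePair (C1coKq i (trBasis N) B cfg 𝔮 𝔮s parS Gp Δ2 U₁) (C1coKq i (trBasis N) B cfg 𝔮 𝔮s parS Gp Δ2 U₁) :=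
  isTransposePair_C1coKq_of_isSymmTr i B cfg 𝔮 𝔮s parS Gp Δ2 U₁ (QG1QinvQY_isSymmTr i 𝔮 𝔮s parS Gp Δ2 (cfg U₁) hG hU hQ hGp hR hΔ2)

end Generic

/-! ## §2 At the knit pair of record `(qKnitOfRecord, qsKnitOfRecord)`, the knit transporter `parKnitY` and `G′_phys(parKnitY)` -/

section Knit

variable [Nonempty (Fin N)] (θ : Stage3Params)

/-- ★★★ **`hC1T` AT THE KNIT PAIR OF RECORD, FROM TWO MEMBER LAWS** — at an SU(N)-valued background `U` whose knit legs `parKnitY U z w` are U(N)-valued (dag-n06-d's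
law KL1 on (3.35), F5's `parKnitY_mem_unitary_of_reg335P`) and with `Δ⁽²⁾(U)` symmetric: `C₁(U) = cR39·coordOpK ((𝔮G₁𝔮⋆)⁻¹(U))` at `(qKnitOfRecord, qsKnitOfRecord, parKnitY,
G′_phys(parKnitY), Δ⁽²⁾)` is its own counting transpose — def-Y's `QG1QinvQY_GpPhysY_isSymmTr_parKnitY` at `G := U(N)` with the adjointness of the knit pair for free
(`qsKnitOfRecord = adjTrY ∘ qKnitOfRecord`, `isAdjTr_adjTrY`). [cite: Balaban1985BackgroundPropagators, (3.132) p.422, (3.115) p.418, (3.13) p.393; Balaban1985Averaging, Prop. 2 p.26] -/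
theorem isTransposePair_C1coKq_knit_of_laws (i : KIdx θ.d₆ θ.ℓ₆ θ.hd' θ.hL' θ.b₀ θ.b₁)
    (B : B9.Backgrounds) (cfg : B.Cfg → CfgY (Matrix (Fin N) (Fin N) ℂ) i) (Δ2 : BondOpY (Matrix (Fin N) (Fin N) ℂ) i) (U₁ : B.Cfg)
    (hU : ∀ μ x, cfg U₁ μ x ∈ specialUnitaryUnits (Fin N))
    (hparK : ∀ z w : SiteY i, parKnitY i (cfg U₁) z w ∈ B7Prop2Explicit.unitaryUnits (Matrix (Fin N) (Fin N) ℂ))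
    (hΔ2 : IsSymmTr (fun _ => (1 : ℝ)) (Δ2 (cfg U₁))) :
    IsTransposePair
      (C1coKq i (trBasis N) B cfg (qKnitOfRecord N θ i) (qsKnitOfRecord N θ i) (parKnitY i) (GpPhysY i (parKnitY i)) Δ2 U₁)
      (C1coKq i (trBasis N) B cfg (qKnitOfRecord N θ i) (qsKnitOfRecord N θ i) (parKnitY i) (GpPhysY i (parKnitY i)) Δ2 U₁) :=
  isTransposePair_C1coKq_of_isSymmTr i B cfg _ _ _ _ Δ2 U₁
    (QG1QinvQY_GpPhysY_isSymmTr_parKnitY i (G := B7Prop2Explicit.unitaryUnits (Matrix (Fin N) (Fin N) ℂ)) (qKnitOfRecord N θ i) (qsKnitOfRecord N θ i) le_rfl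
      (fun μ x => specialUnitaryUnits_le_unitaryUnits (hU μ x)) hparK (isAdjTr_adjTrY (qKnitOfRecord N θ i (cfg U₁))) Δ2 hΔ2)

variable (Mstar : ℕ) {R₁ R₂ : RegFamY θ.d₆ θ.ℓ₆ θ.hd' θ.hL' θ.b₀ θ.b₁ Mstar (Matrix (Fin N) (Fin N) ℂ)} {c : ℝ}

/-- ★★★ **THE CERTIFICATE's BINDER `hC1T` AT THE KNIT PAIR, FROM TWO DISPLAYED MEMBER LAWS**: at any Sect.-D record `𝔬12` whose `C1` is pinned to def-Y's knit model
(`hC1co12`, `Node00.OpsYOps312OfRecordPar.pins312K_of_eq`'s conjunct), over the class-parametric carrier `bg9YR … R₁ R₂` with `R₁` SU(N)-valued (`hGR`), the laws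
`hparK` (knit legs U(N)-valued on the classes — dag-n06-d's KL1) and `hΔ2` (`Δ⁽²⁾(U)` symmetric at SU(N)-valued `U` — the C2 programme's `resYOfC2P_Δ2_isSymmTr_SU` ∕
`c2YOfRecord_real_SU` shape) give `t312_t313_of_pins_stateSUCLE_par`'s `hC1T` VERBATIM (any threshold prefix `M12 ∕ a12`).
[cite: Balaban1985BackgroundPropagators, (3.132) p.422, Thm 3.13 p.426, (3.35)–(3.36) p.396; Balaban1985Averaging, Prop. 2 p.26] -/
theorem hC1T_knit_of_laws (hGR : MemOfFam (specialUnitaryUnits (Fin N)) R₁)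
    {X12 Y12 W12 : MemberY θ.d₆ θ.ℓ₆ θ.hd' θ.hL' θ.b₀ θ.b₁ Mstar → Type} [∀ x, Fintype (X12 x)] [∀ x, Fintype (Y12 x)] [∀ x, Fintype (W12 x)]
    (𝔬12 : ∀ x : MemberY θ.d₆ θ.ℓ₆ θ.hd' θ.hL' θ.b₀ θ.b₁ Mstar, Ops (geo9Y x) (bg9YR (Matrix (Fin N) (Fin N) ℂ) (specialUnitaryUnits (Fin N)) R₁ R₂ x) (X12 x) (Y12 x) (XHK (TrIdx N) x.toKIdx) (W12 x))
    (Δ2 : ∀ x : MemberY θ.d₆ θ.ℓ₆ θ.hd' θ.hL' θ.b₀ θ.b₁ Mstar, BondOpY (Matrix (Fin N) (Fin N) ℂ) x.toKIdx)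
    (hC1co12 : ∀ (x : MemberY θ.d₆ θ.ℓ₆ θ.hd' θ.hL' θ.b₀ θ.b₁ Mstar) (U : (bg9YR (Matrix (Fin N) (Fin N) ℂ) (specialUnitaryUnits (Fin N)) R₁ R₂ x).Cfg),
      (𝔬12 x).C1 U = C1coKq x.toKIdx (trBasis N) (bg9YR (Matrix (Fin N) (Fin N) ℂ) (specialUnitaryUnits (Fin N)) R₁ R₂ x) (fun U => U)
        (qKnitOfRecord N θ x.toKIdx) (qsKnitOfRecord N θ x.toKIdx) (parKnitY x.toKIdx) (GpPhysY x.toKIdx (parKnitY x.toKIdx)) (Δ2 x) U)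
    {M12 a12 : ℝ}
    (hparK : ∀ x : MemberY θ.d₆ θ.ℓ₆ θ.hd' θ.hL' θ.b₀ θ.b₁ Mstar, M12 ≤ (geo9Y x).M → ∀ α₀ : ℝ, 0 < α₀ → (geo9Y x).M * α₀ ≤ a12 →
      ∀ U : (bg9YR (Matrix (Fin N) (Fin N) ℂ) (specialUnitaryUnits (Fin N)) R₁ R₂ x).Cfg, (bg9YR (Matrix (Fin N) (Fin N) ℂ) (specialUnitaryUnits (Fin N)) R₁ R₂ x).Reg335 c α₀ U →
        ∀ z w : SiteY x.toKIdx, parKnitY x.toKIdx U z w ∈ B7Prop2Explicit.unitaryUnits (Matrix (Fin N) (Fin N) ℂ))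
    (hΔ2 : ∀ (x : MemberY θ.d₆ θ.ℓ₆ θ.hd' θ.hL' θ.b₀ θ.b₁ Mstar) (U : (bg9YR (Matrix (Fin N) (Fin N) ℂ) (specialUnitaryUnits (Fin N)) R₁ R₂ x).Cfg),
      (∀ μ z, U μ z ∈ specialUnitaryUnits (Fin N)) → IsSymmTr (fun _ => (1 : ℝ)) (Δ2 x U)) :
    ∀ x : MemberY θ.d₆ θ.ℓ₆ θ.hd' θ.hL' θ.b₀ θ.b₁ Mstar, M12 ≤ (geo9Y x).M → ∀ α₀ : ℝ, 0 < α₀ → (geo9Y x).M * α₀ ≤ a12 →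
      ∀ U : (bg9YR (Matrix (Fin N) (Fin N) ℂ) (specialUnitaryUnits (Fin N)) R₁ R₂ x).Cfg, (bg9YR (Matrix (Fin N) (Fin N) ℂ) (specialUnitaryUnits (Fin N)) R₁ R₂ x).Reg335 c α₀ U →
        (bg9YR (Matrix (Fin N) (Fin N) ℂ) (specialUnitaryUnits (Fin N)) R₁ R₂ x).Reg336 c α₀ U → IsTransposePair ((𝔬12 x).C1 U) ((𝔬12 x).C1 U) := by
  intro x hM α₀ hα ha U hU _
  have hUG : ∀ μ z, U μ z ∈ specialUnitaryUnits (Fin N) := mem_of_reg335R hGR x hU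
  rw [hC1co12 x U]
  exact isTransposePair_C1coKq_knit_of_laws θ x.toKIdx (bg9YR (Matrix (Fin N) (Fin N) ℂ) (specialUnitaryUnits (Fin N)) R₁ R₂ x) (fun U => U) (Δ2 x) U hUG
    (hparK x hM α₀ hα ha U hU) (hΔ2 x U hUG)

end Knit

end Summit.QuantumFields.YangMills.BalabanUVNodes.N06Thm312313ParLawsQ

end
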